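import Summits.QuantumFields.BalabanUV.Beta.GAN24.AliasWeightsSum
import Summits.QuantumFields.BalabanUV.Beta.GAN24.FibreDFT

/-!
# `BalabanUV.Beta.GAN24.AliasClassSum` — binder row G-an2-4 ∕ (CONV-C), road P1-fibre layer; cross-lane supply for road «FP» (binder row D1)
# row **N7/IPROF-UNIF**: THE ALIAS CLASSES MODULO A RELATIVE BLOCKING `L` (`N = L·M`) — the shifted one-coordinate alias sum is `≤ 5`
# at EVERY real phase, every residue class mod `L` of `(ℤ∕N)^D` carries `M`-box weight `≤ 5^D`, and PARSEVAL over the box `(ℤ∕L)^D`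
# for coefficients on `(ℤ∕N)^D` grouped by their class

NOT IN PRINT; OUR BOOKKEEPING ([folklore] trigonometric sums and finite Fourier analysis; every constant displayed).  HONEST FRAMING (cell
contract, verbatim): «discharging `BetaPertH` makes Bałaban's UV stability UNCONDITIONAL — a real constructive-QFT result; it is NOT the continuum
limit and NOT the Clay problem.»  HONEST DEPENDENCY (verbatim): «continuum YM on T⁴ ⇐ BetaPertH ∧ nine spine estimates (0/9 proved); BetaPertH ⇐
(D1) ∧ (D4) ∧ CAP+tail; G-an2-4 gates asym, D1 and NE2/3/4.»  THIS MODULE DISCHARGES NOTHING of (CONV-C), N7, `hasym`, row D1; no cited fact, no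
wall binder, no `def … : Prop`; NOT summit progress.  Unit `b2b-balaban-gan24-formalise-leaf-04` (gen 38; idle G-an2-4 swarm leaf seat, cross-lane on the
road-FP owner's row IPROF-UNIF, `HOME/b2b-balaban-beta-d1-p3/LEAVES-FP.md`).

WHY (located).  Road P1's (U2) bounds the M-level reading vector in `ℓ²` over ALL `N^D` aliases through the change-of-box majorant
`AliasWeights.sinWt_le_sq_mul_sinWt`, costing `((N∕M)²)^D = L^{2D}` (`StripLegVectors.sum_norm_readW_sq_le_strip`) — the factor that keeps the perfect minimiser
column at the power `p = 1` in `FP/PerfectColumnUniform` (p229339).  The reading phase at a box representative `ρ ∈ [0,L)^D` depends on the alias only through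
its CLASS mod `L` (`M∕N = 1∕L`), so after Parseval over the `L^D` representatives only WITHIN-CLASS sums are needed, and a class `m = m′ + L·n`, `n ∈ (ℤ∕M)^D`,
shifts `kfine∕2` by `π·n_i∕M`: after a `π∕M`-periodicity reduction of the phase each class sum IS `AliasWeightsSum.sum_wMaj_le` at level `M` — `≤ 5^D`,
uniformly in `N, M, L, q`.  Consumer: `FP/PerfectColumnMassFibre` (the box-summed (U2) of the field–multiplier quarter with `L^D` in place of `L^{2D}`).

CONTENT (generic `D`; all [folklore]):
* §1 `shWt M θ = 1∕max(1,(M sin θ)²)` (`= sinWt M (2θ)`), `shSum M θ = Σ_{n ∈ ℤ∕M} shWt M (θ + π·val n∕M)`; `π`-periodicity of `shWt`, `π∕M`-periodicity of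
  `shSum` (`shSum_add_pi_div`), reduction of any real phase to `|θ₀| ≤ π∕(2M)` and **`shSum_le_five`**: `shSum M θ ≤ 5` for EVERY real `θ`
  (`AliasWeights.sinWt_kfine_le_wMaj` + `AliasWeightsSum.sum_wMaj_le` at the reduced phase).
* §2 `cls L m` (the class of `m ∈ (ℤ∕N)^D` mod `L`, coordinatewise `val mod L`), `lift m′ n` (the member `val m′ + L·val n` of the class of `m′`, `n ∈ (ℤ∕M)^D`,
  for `N = L·M`), `lift_val`, `cls_lift`, `lift_injective`, the class as the image of `lift` (`filter_cls_eq_image`, `sum_cls_eq`), the half fine momentum of a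
  lifted alias (`kfine_lift_div_two`) and **`sum_cls_prod_sinWt_le`**: `Σ_{m : cls L m = m′} Π_i sinWt M (kfine N q m i) ≤ 5^D` for EVERY real `q`.
* §3 `boxChar` algebra on `(ℤ∕L)^D` (`boxChar_add_left`, `conj_boxChar`) and **PARSEVAL BY CLASSES** `sum_norm_sq_boxChar_cls`:
  `Σ_{z ∈ (ℤ∕L)^D} ‖Σ_m b m·boxChar (cls L m) z‖² = L^D·Σ_{m′ ∈ (ℤ∕L)^D} ‖Σ_{m : cls L m = m′} b m‖²` (`FibreDFT.sum_boxChar'`).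
* §4 **`sum_norm_sq_boxChar_cls_le`**: with weights `σ_m > 0`, `(σ_m‖c_m‖)² ≤ w_m` and class sums `Σ_{cls m = m′} w_m ≤ W`:
  `Σ_z ‖Σ_m c_m·a_m·boxChar (cls L m) z‖² ≤ L^D·W·Σ_m (‖a_m‖∕σ_m)²` (Cauchy–Schwarz INSIDE each class, the `ℓ²` sum over ALL aliases kept whole).

ABSOLUTE RULE (cell, verbatim): «No internally-minted statement may enter as a cited fact. Every hypothesis is either kernel-proved in this package or a
verbatim quotation of a PUBLISHED theorem with page reference.»  Nothing is cited; three explicit data defs (`shWt`, `shSum`, `cls`, `lift` are [our object]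
abbreviations of displayed formulas); every input is a tree theorem imported BY NAME.
-/

noncomputable section

open Complex Finset
open scoped BigOperators Real ComplexConjugate
open Literature.Probability.LatticeModels (TorusSite)
open Summit.QuantumFields.BalabanUV.Beta.GAN24.AliasWeights (sinWt sinWt_pos sinWt_le_one kfine wMaj wMaj_nonneg sinWt_kfine_le_wMaj)
open Summit.QuantumFields.BalabanUV.Beta.GAN24.AliasWeightsSum (sum_wMaj_le)
open Summit.QuantumFields.BalabanUV.Beta.GAN24.FibreDFT (boxChar sum_boxChar')

namespace Summit.QuantumFields.BalabanUV.Beta.GAN24.AliasClassSum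

variable {D : ℕ}

/-! ## §1 The shifted one-coordinate alias sum is `≤ 5` at every real phase -/

/-- [our object] The shifted one-coordinate weight at phase `θ`: `1 ∕ max(1, (M·sin θ)²)` (`= sinWt M (2θ)`). -/
def shWt (M : ℕ) (θ : ℝ) : ℝ := 1 / max 1 (((M : ℝ) * Real.sin θ) ^ 2)

/-- [folklore] `shWt M θ = sinWt M (2θ)`. -/
theorem shWt_eq_sinWt (M : ℕ) (θ : ℝ) : shWt M θ = sinWt M (2 * θ) := by
  unfold shWt sinWt
  rw [mul_div_cancel_left₀ θ two_ne_zero]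

/-- [folklore] `sinWt M x = shWt M (x∕2)`. -/
theorem sinWt_eq_shWt (M : ℕ) (x : ℝ) : sinWt M x = shWt M (x / 2) := rfl
/-- [folklore] `0 ≤ shWt`. -/
theorem shWt_nonneg (M : ℕ) (θ : ℝ) : 0 ≤ shWt M θ := by rw [shWt_eq_sinWt]; exact (sinWt_pos _ _).le
/-- [folklore] `π`-PERIODICITY: `shWt M (θ + k·π) = shWt M θ` for every integer `k` (`sin(θ + kπ) = ±sin θ`). -/
theorem shWt_add_int_mul_pi (M : ℕ) (θ : ℝ) (k : ℤ) : shWt M (θ + k * π) = shWt M θ := by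
  unfold shWt
  rw [Real.sin_add_int_mul_pi]
  have h1 : ((-1 : ℝ) ^ k) ^ 2 = 1 := by
    rw [← zpow_natCast, ← zpow_mul]
    exact Even.neg_one_zpow ⟨k, by push_cast; ring⟩
  have h : ((M : ℝ) * ((-1) ^ k * Real.sin θ)) ^ 2 = ((M : ℝ) * Real.sin θ) ^ 2 := by
    calc ((M : ℝ) * ((-1) ^ k * Real.sin θ)) ^ 2 = ((-1 : ℝ) ^ k) ^ 2 * ((M : ℝ) * Real.sin θ) ^ 2 := by ring
      _ = ((M : ℝ) * Real.sin θ) ^ 2 := by rw [h1, one_mul]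
  rw [h]

/-- [folklore] `shWt M (θ + π) = shWt M θ`. -/
theorem shWt_add_pi (M : ℕ) (θ : ℝ) : shWt M (θ + π) = shWt M θ := by simpa using shWt_add_int_mul_pi M θ 1
/-- [our object] THE SHIFTED ONE-COORDINATE ALIAS SUM `S_M(θ) = Σ_{n ∈ ℤ∕M} shWt M (θ + π·val n ∕ M)`. -/
def shSum (M : ℕ) [NeZero M] (θ : ℝ) : ℝ := ∑ n : ZMod M, shWt M (θ + π * (n.val : ℝ) / M)

/-- [folklore] `shSum` over `ℤ∕M` is the sum over the box representatives `0 ≤ k < M`. -/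
theorem shSum_eq_range (M : ℕ) [NeZero M] (θ : ℝ) : shSum M θ = ∑ k ∈ Finset.range M, shWt M (θ + π * (k : ℝ) / M) := by
  obtain ⟨k, rfl⟩ := Nat.exists_eq_succ_of_ne_zero (NeZero.ne M)
  unfold shSum
  exact Fin.sum_univ_eq_sum_range (fun i => shWt (k + 1) (θ + π * (i : ℝ) / ((k + 1 : ℕ) : ℝ))) (k + 1)

/-- [folklore] **`π∕M`-PERIODICITY OF THE SHIFTED SUM**: `shSum M (θ + π∕M) = shSum M θ` (the shift re-indexes `k ↦ k + 1`; the term leaving at `k = M` is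
`shWt M (θ + π) = shWt M θ`, the term entering at `k = 0`). -/
theorem shSum_add_pi_div (M : ℕ) [NeZero M] (θ : ℝ) : shSum M (θ + π / M) = shSum M θ := by
  have hM : (M : ℝ) ≠ 0 := Nat.cast_ne_zero.2 (NeZero.ne M)
  rw [shSum_eq_range, shSum_eq_range]
  set f : ℕ → ℝ := fun k => shWt M (θ + π * (k : ℝ) / M) with hf
  have hshift : ∀ k : ℕ, shWt M (θ + π / M + π * (k : ℝ) / M) = f (k + 1) := by
    intro k
    simp only [hf, Nat.cast_add, Nat.cast_one]
    congr 1
    field_simp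
    ring
  simp_rw [hshift]
  have h1 := Finset.sum_range_succ' f M
  have h2 := Finset.sum_range_succ f M
  have h3 : f M = f 0 := by
    simp only [hf, Nat.cast_zero, mul_zero, zero_div, add_zero]
    rw [mul_div_assoc, div_self hM, mul_one, shWt_add_pi]
  linarith

/-- [folklore] Iterated: `shSum M (θ + n·(π∕M)) = shSum M θ` for every `n : ℕ`. -/
theorem shSum_add_nat_mul (M : ℕ) [NeZero M] (θ : ℝ) (n : ℕ) : shSum M (θ + n * (π / M)) = shSum M θ := by
  induction n with
  | zero => simp
  | succ n ih =>
      have : θ + ((n + 1 : ℕ) : ℝ) * (π / M) = (θ + n * (π / M)) + π / M := by push_cast; ring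
      rw [this, shSum_add_pi_div, ih]

/-- [folklore] Integer shifts: `shSum M (θ + j·(π∕M)) = shSum M θ` for every `j : ℤ`. -/
theorem shSum_add_int_mul (M : ℕ) [NeZero M] (θ : ℝ) (j : ℤ) : shSum M (θ + j * (π / M)) = shSum M θ := by
  obtain ⟨n, rfl | rfl⟩ := Int.eq_nat_or_neg j
  · exact_mod_cast shSum_add_nat_mul M θ n
  · have h := shSum_add_nat_mul M (θ + ((-(n : ℤ) : ℤ) : ℝ) * (π / M)) n
    rw [← h]
    congr 1
    push_cast; ring

/-- [folklore] THE SHIFTED SUM AT A SMALL PHASE IS A `kfine`-SUM AT LEVEL `M`: for `|θ₀| ≤ π∕(2M)`, with `q := 2Mθ₀` (`|q| ≤ π`),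
`shSum M θ₀ = Σ_{n} sinWt M (kfine M (fun _ => q) (fun _ => n) 0)`. -/
theorem shSum_eq_sum_sinWt_kfine (M : ℕ) [NeZero M] (θ₀ : ℝ) :
    shSum M θ₀ = ∑ n : ZMod M, sinWt M (kfine M (fun _ : Fin 1 => 2 * (M : ℝ) * θ₀) (fun _ : Fin 1 => n) 0) := by
  have hM : (M : ℝ) ≠ 0 := Nat.cast_ne_zero.2 (NeZero.ne M)
  unfold shSum
  refine Finset.sum_congr rfl fun n _ => ?_
  rw [sinWt_eq_shWt]
  congr 1
  simp only [kfine]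
  field_simp

/-- [folklore] **THE SHIFTED ONE-COORDINATE ALIAS SUM IS `≤ 5` AT EVERY REAL PHASE**: `Σ_{n ∈ ℤ∕M} 1∕max(1,(M sin(θ + π val n∕M))²) ≤ 5`
(reduce `θ` by an integer multiple of `π∕M` to `|θ₀| ≤ π∕(2M)`, then `AliasWeights.sinWt_kfine_le_wMaj` at `|2Mθ₀| ≤ π` and `AliasWeightsSum.sum_wMaj_le`). -/
theorem shSum_le_five (M : ℕ) [NeZero M] (θ : ℝ) : shSum M θ ≤ 5 := by
  have hM0 : (0 : ℝ) < M := Nat.cast_pos.2 (Nat.pos_of_ne_zero (NeZero.ne M))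
  have hπ := Real.pi_pos
  -- reduce the phase
  set t : ℝ := θ * M / π + 1 / 2 with ht
  set j : ℤ := ⌊t⌋ with hj
  set θ₀ : ℝ := θ + (-j : ℤ) * (π / M) with hθ₀
  have hred : shSum M θ = shSum M θ₀ := by rw [hθ₀, shSum_add_int_mul]
  have hfl1 : (j : ℝ) ≤ t := Int.floor_le t
  have hfl2 : t < j + 1 := Int.lt_floor_add_one t
  have hMne : (M : ℝ) ≠ 0 := hM0.ne'
  have hθ₀' : θ₀ = (t - 1 / 2 - j) * (π / M) := by
    rw [hθ₀, ht]; push_cast; field_simp; ring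
  have hsmall : |2 * (M : ℝ) * θ₀| ≤ π := by
    rw [hθ₀', abs_le]
    constructor
    · have : -(1 : ℝ) / 2 ≤ t - 1 / 2 - j := by linarith
      have h2 : 2 * (M : ℝ) * ((t - 1 / 2 - ↑j) * (π / ↑M)) = 2 * (t - 1 / 2 - j) * π := by field_simp
      rw [h2]; nlinarith
    · have : t - 1 / 2 - j ≤ 1 / 2 := by linarith
      have h2 : 2 * (M : ℝ) * ((t - 1 / 2 - ↑j) * (π / ↑M)) = 2 * (t - 1 / 2 - j) * π := by field_simp
      rw [h2]; nlinarith
  rw [hred, shSum_eq_sum_sinWt_kfine]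
  calc ∑ n : ZMod M, sinWt M (kfine M (fun _ : Fin 1 => 2 * (M : ℝ) * θ₀) (fun _ : Fin 1 => n) 0)
      ≤ ∑ n : ZMod M, wMaj M n :=
        Finset.sum_le_sum fun n _ => sinWt_kfine_le_wMaj (fun _ => hsmall) (fun _ : Fin 1 => n) 0
    _ ≤ 5 := sum_wMaj_le M

/-- [folklore] `0 ≤ shSum`. -/
theorem shSum_nonneg (M : ℕ) [NeZero M] (θ : ℝ) : 0 ≤ shSum M θ := Finset.sum_nonneg fun _ _ => shWt_nonneg _ _

/-! ## §2 Alias classes modulo a relative blocking `L` (`N = L·M`) and their `M`-box weight -/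

section Classes

variable {L M N : ℕ}

/-- [our object] THE CLASS of an alias `m ∈ (ℤ∕N)^D` modulo `L`: coordinatewise `val m_i mod L`. -/
def cls (L : ℕ) (m : TorusSite D N) : TorusSite D L := fun i => ((m i).val : ZMod L)

/-- [folklore] `val (cls L m)_i = val m_i % L`. -/
theorem cls_val (L : ℕ) (m : TorusSite D N) (i : Fin D) : (cls L m i).val = (m i).val % L := ZMod.val_natCast _ _

/-- [our object] THE MEMBERS OF A CLASS: `lift m′ n` has box representative `val m′_i + L·val n_i` (`n ∈ (ℤ∕M)^D`; for `N = L·M` these are `< N`). -/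
def lift (L : ℕ) (m' : TorusSite D L) (n : TorusSite D M) : TorusSite D N := fun i => (((m' i).val + L * (n i).val : ℕ) : ZMod N)

/-- [folklore] The representative of a lifted alias is `< N = L·M`. -/
theorem val_add_mul_val_lt [NeZero L] [NeZero M] (hN : N = L * M) (m' : TorusSite D L) (n : TorusSite D M) (i : Fin D) :
    (m' i).val + L * (n i).val < N := by
  have h3 : (m' i).val + L * (n i).val < L + L * (n i).val := Nat.add_lt_add_right (ZMod.val_lt _) _
  have h4 : L + L * (n i).val = L * ((n i).val + 1) := by ring
  have h5 : L * ((n i).val + 1) ≤ L * M := Nat.mul_le_mul_left L (ZMod.val_lt _)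
  omega

/-- [folklore] `val (lift m′ n)_i = val m′_i + L·val n_i` (`N = L·M`). -/
theorem lift_val [NeZero L] [NeZero M] (hN : N = L * M) (m' : TorusSite D L) (n : TorusSite D M) (i : Fin D) :
    (lift (N := N) L m' n i).val = (m' i).val + L * (n i).val :=
  ZMod.val_natCast_of_lt (val_add_mul_val_lt hN m' n i)

/-- [folklore] A lifted alias lies in the class it was lifted from: `cls L (lift m′ n) = m′`. -/
theorem cls_lift [NeZero L] [NeZero M] (hN : N = L * M) (m' : TorusSite D L) (n : TorusSite D M) :
    cls L (lift (N := N) L m' n) = m' := by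
  funext i; apply ZMod.val_injective L
  rw [cls_val, lift_val hN, Nat.add_mul_mod_self_left, Nat.mod_eq_of_lt (ZMod.val_lt _)]

/-- [folklore] `lift m′` is injective on `(ℤ∕M)^D` (`N = L·M`). -/
theorem lift_injective [NeZero L] [NeZero M] (hN : N = L * M) (m' : TorusSite D L) :
    Function.Injective (lift (N := N) (M := M) L m') := by
  intro n n' h; funext i; apply ZMod.val_injective M
  have hi := congrArg (fun m : TorusSite D N => (m i).val) h
  simp only [lift_val hN] at hi
  have hL : 0 < L := Nat.pos_of_ne_zero (NeZero.ne L)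
  have := Nat.add_left_cancel hi
  exact Nat.eq_of_mul_eq_mul_left hL this

/-- [folklore] Every member of the class of `m′` is a lift: `cls L m = m′ ⟹ ∃ n, lift m′ n = m` (`n_i := val m_i ∕ L`). -/
theorem exists_lift_eq [NeZero L] [NeZero M] [NeZero N] (hN : N = L * M) {m' : TorusSite D L} {m : TorusSite D N}
    (h : cls L m = m') : ∃ n : TorusSite D M, lift (N := N) L m' n = m := by
  have hL : 0 < L := Nat.pos_of_ne_zero (NeZero.ne L)
  refine ⟨fun i => (((m i).val / L : ℕ) : ZMod M), ?_⟩
  funext i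
  have hdiv : (m i).val / L < M := by
    rw [Nat.div_lt_iff_lt_mul hL, mul_comm, ← hN]
    exact ZMod.val_lt (m i)
  have hm' : (m' i).val = (m i).val % L := by rw [← h, cls_val]
  unfold lift
  rw [ZMod.val_natCast_of_lt hdiv, hm', Nat.mod_add_div]
  exact ZMod.natCast_zmod_val (m i)

/-- [folklore] THE CLASS OF `m′` IS THE IMAGE OF `lift m′`. -/
theorem filter_cls_eq_image [NeZero L] [NeZero M] [NeZero N] (hN : N = L * M) (m' : TorusSite D L) :
    (Finset.univ.filter fun m : TorusSite D N => cls L m = m') = Finset.univ.image (lift (N := N) (M := M) L m') := by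
  ext m
  simp only [Finset.mem_filter, Finset.mem_univ, true_and, Finset.mem_image]
  exact ⟨fun h => exists_lift_eq hN h, fun ⟨n, hn⟩ => hn ▸ cls_lift hN m' n⟩

/-- [folklore] A CLASS SUM IS A SUM OVER `(ℤ∕M)^D`: `Σ_{m : cls L m = m′} f m = Σ_{n} f (lift m′ n)`. -/
theorem sum_cls_eq [NeZero L] [NeZero M] [NeZero N] {β : Type*} [AddCommMonoid β] (hN : N = L * M) (m' : TorusSite D L)
    (f : TorusSite D N → β) :
    ∑ m ∈ Finset.univ.filter (fun m : TorusSite D N => cls L m = m'), f m = ∑ n : TorusSite D M, f (lift (N := N) L m' n) := by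
  rw [filter_cls_eq_image hN, Finset.sum_image fun n _ n' _ h => lift_injective hN m' h]

/-- [folklore] HALF THE FINE MOMENTUM OF A LIFTED ALIAS: `kfine N q (lift m′ n) i ∕ 2 = (q_i + 2π val m′_i)∕(2N) + π·val n_i∕M` (`L∕N = 1∕M`). -/
theorem kfine_lift_div_two [NeZero L] [NeZero M] [NeZero N] (hN : N = L * M) (q : Fin D → ℝ) (m' : TorusSite D L)
    (n : TorusSite D M) (i : Fin D) :
    kfine N q (lift (N := N) L m' n) i / 2 = (q i + 2 * π * ((m' i).val : ℝ)) / (2 * N) + π * ((n i).val : ℝ) / M := by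
  have hM : (M : ℝ) ≠ 0 := Nat.cast_ne_zero.2 (NeZero.ne M)
  have hL : (L : ℝ) ≠ 0 := Nat.cast_ne_zero.2 (NeZero.ne L)
  have hNr : (N : ℝ) = (L : ℝ) * M := by rw [hN, Nat.cast_mul]
  simp only [kfine, lift_val hN, Nat.cast_add, Nat.cast_mul]
  rw [hNr]; field_simp; ring

/-- [folklore] The `M`-box weight of a lifted alias is the shifted weight at the class phase. -/
theorem sinWt_kfine_lift [NeZero L] [NeZero M] [NeZero N] (hN : N = L * M) (q : Fin D → ℝ) (m' : TorusSite D L)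
    (n : TorusSite D M) (i : Fin D) :
    sinWt M (kfine N q (lift (N := N) L m' n) i) = shWt M ((q i + 2 * π * ((m' i).val : ℝ)) / (2 * N) + π * ((n i).val : ℝ) / M) := by
  rw [sinWt_eq_shWt, kfine_lift_div_two hN]

/-- [folklore] **EVERY CLASS MOD `L` CARRIES `M`-BOX WEIGHT AT MOST `5^D`**: for `N = L·M`, every real `q` and every class `m′ ∈ (ℤ∕L)^D`,
`Σ_{m ∈ (ℤ∕N)^D : cls L m = m′} Π_i sinWt M (kfine N q m i) ≤ 5^D` — uniformly in `N`, `M`, `L`, `q` (product formula over the coordinates of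
`n ∈ (ℤ∕M)^D` and §1 at the class phases). -/
theorem sum_cls_prod_sinWt_le [NeZero L] [NeZero M] [NeZero N] (hN : N = L * M) (q : Fin D → ℝ) (m' : TorusSite D L) :
    ∑ m ∈ Finset.univ.filter (fun m : TorusSite D N => cls L m = m'), ∏ i, sinWt M (kfine N q m i) ≤ (5 : ℝ) ^ D := by
  rw [sum_cls_eq hN]
  simp_rw [sinWt_kfine_lift hN]
  set θ : Fin D → ℝ := fun i => (q i + 2 * π * ((m' i).val : ℝ)) / (2 * N) with hθ
  have hprod := Fintype.prod_sum (fun (i : Fin D) (r : ZMod M) => shWt M (θ i + π * (r.val : ℝ) / M))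
  -- `hprod : ∏ i, ∑ r, shWt M (θ i + π r∕M) = ∑ n, ∏ i, shWt M (θ i + π (n i)∕M)`
  have hrw : ∑ n : TorusSite D M, ∏ i, shWt M ((q i + 2 * π * ((m' i).val : ℝ)) / (2 * N) + π * ((n i).val : ℝ) / M)
      = ∏ i, ∑ r : ZMod M, shWt M (θ i + π * (r.val : ℝ) / M) := by
    rw [hprod]
  rw [hrw]
  have h0 : ∀ i, 0 ≤ ∑ r : ZMod M, shWt M (θ i + π * (r.val : ℝ) / M) := fun i => shSum_nonneg M (θ i)
  have h5 : ∀ i, ∑ r : ZMod M, shWt M (θ i + π * (r.val : ℝ) / M) ≤ 5 := fun i => shSum_le_five M (θ i)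
  calc ∏ i, ∑ r : ZMod M, shWt M (θ i + π * (r.val : ℝ) / M) ≤ ∏ _i : Fin D, (5 : ℝ) :=
        Finset.prod_le_prod (fun i _ => h0 i) fun i _ => h5 i
    _ = (5 : ℝ) ^ D := by rw [Finset.prod_const, Finset.card_univ, Fintype.card_fin]

end Classes

/-! ## §3 Parseval over the box `(ℤ∕L)^D` for coefficients grouped by class -/

section Parseval

variable {L N : ℕ} [NeZero L] [NeZero N]

/-- [folklore] `boxChar` is additive in its first argument. -/
theorem boxChar_add_left (a b z : TorusSite D L) : boxChar (a + b) z = boxChar a z * boxChar b z := by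
  unfold boxChar; rw [← Finset.prod_mul_distrib]
  exact Finset.prod_congr rfl fun μ _ => by rw [Pi.add_apply, add_mul, AddChar.map_add_eq_mul]

/-- [folklore] `conj (boxChar a z) = boxChar (−a) z`. -/
theorem conj_boxChar (a z : TorusSite D L) : conj (boxChar a z) = boxChar (-a) z := by
  unfold boxChar; rw [map_prod]
  exact Finset.prod_congr rfl fun μ _ => by rw [Pi.neg_apply, neg_mul, AddChar.map_neg_eq_conj]

/-- [folklore] `boxChar a z · conj (boxChar b z) = boxChar (a − b) z`. -/
theorem boxChar_mul_conj (a b z : TorusSite D L) : boxChar a z * conj (boxChar b z) = boxChar (a - b) z := by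
  rw [conj_boxChar, ← boxChar_add_left, sub_eq_add_neg]

/-- [folklore] **PARSEVAL ON `(ℤ∕L)^D`**: `Σ_z ‖Σ_a B a · boxChar a z‖² = L^D · Σ_a ‖B a‖²`. -/
theorem sum_norm_sq_boxChar (B : TorusSite D L → ℂ) :
    ∑ z : TorusSite D L, ‖∑ a, B a * boxChar a z‖ ^ 2 = (L : ℝ) ^ D * ∑ a, ‖B a‖ ^ 2 := by
  -- work in `ℂ`
  have key : ∀ z : TorusSite D L, ((‖∑ a, B a * boxChar a z‖ : ℂ)) ^ 2 = ∑ a, ∑ b, B a * conj (B b) * boxChar (a - b) z := by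
    intro z
    rw [← Complex.mul_conj', map_sum, Finset.sum_mul_sum]
    refine Finset.sum_congr rfl fun a _ => Finset.sum_congr rfl fun b _ => ?_
    rw [map_mul, ← boxChar_mul_conj]
    ring
  have inner : ∀ a : TorusSite D L, ∑ z : TorusSite D L, ∑ b, B a * conj (B b) * boxChar (a - b) z = (L : ℂ) ^ D * (B a * conj (B a)) := by
    intro a
    rw [Finset.sum_comm]
    have hb : ∀ b : TorusSite D L, ∑ z : TorusSite D L, B a * conj (B b) * boxChar (a - b) z
        = if a = b then B a * conj (B b) * (L : ℂ) ^ D else 0 := by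
      intro b
      rw [← Finset.mul_sum, sum_boxChar']
      by_cases hab : a = b
      · subst hab
        simp
      · rw [if_neg (sub_ne_zero.2 hab), if_neg hab, mul_zero]
    simp_rw [hb]
    rw [Finset.sum_ite_eq Finset.univ a (fun b => B a * conj (B b) * (L : ℂ) ^ D)]
    simp only [Finset.mem_univ, if_true]
    ring
  apply Complex.ofReal_injective
  push_cast
  simp_rw [key]
  rw [Finset.sum_comm]
  simp_rw [inner]
  rw [← Finset.mul_sum]
  exact congrArg _ (Finset.sum_congr rfl fun a _ => by rw [Complex.mul_conj'])

/-- [folklore] **PARSEVAL BY CLASSES**: for coefficients `b` on `(ℤ∕N)^D` read through the character of their class mod `L`,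
`Σ_{z ∈ (ℤ∕L)^D} ‖Σ_m b m · boxChar (cls L m) z‖² = L^D · Σ_{m′} ‖Σ_{m : cls L m = m′} b m‖²`. -/
theorem sum_norm_sq_boxChar_cls (b : TorusSite D N → ℂ) :
    ∑ z : TorusSite D L, ‖∑ m : TorusSite D N, b m * boxChar (cls L m) z‖ ^ 2
      = (L : ℝ) ^ D * ∑ m' : TorusSite D L, ‖∑ m ∈ Finset.univ.filter (fun m : TorusSite D N => cls L m = m'), b m‖ ^ 2 := by
  have hgroup : ∀ z : TorusSite D L, ∑ m : TorusSite D N, b m * boxChar (cls L m) z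
      = ∑ m' : TorusSite D L, (∑ m ∈ Finset.univ.filter (fun m : TorusSite D N => cls L m = m'), b m) * boxChar m' z := by
    intro z
    rw [← Finset.sum_fiberwise Finset.univ (cls L) (fun m : TorusSite D N => b m * boxChar (cls L m) z)]
    refine Finset.sum_congr rfl fun m' _ => ?_
    rw [Finset.sum_mul]
    refine Finset.sum_congr rfl fun m hm => ?_
    rw [(Finset.mem_filter.1 hm).2]
  simp_rw [hgroup]
  exact sum_norm_sq_boxChar _

end Parseval

/-! ## §4 Cauchy–Schwarz inside the classes -/

section CauchySchwarz

variable {L N : ℕ} [NeZero L] [NeZero N]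

/-- [folklore] Weighted Cauchy–Schwarz over a finset: `‖Σ_{i∈s} c i·a i‖² ≤ (Σ_{i∈s} (σ i·‖c i‖)²)·(Σ_{i∈s} (‖a i‖∕σ i)²)` (`σ > 0`). -/
theorem norm_sum_mul_sq_le_finset {ι : Type*} (s : Finset ι) (c a : ι → ℂ) (σ : ι → ℝ) (hσ : ∀ i, 0 < σ i) :
    ‖∑ i ∈ s, c i * a i‖ ^ 2 ≤ (∑ i ∈ s, (σ i * ‖c i‖) ^ 2) * (∑ i ∈ s, (‖a i‖ / σ i) ^ 2) := by
  have h1 : ‖∑ i ∈ s, c i * a i‖ ≤ ∑ i ∈ s, (σ i * ‖c i‖) * (‖a i‖ / σ i) := by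
    refine (norm_sum_le _ _).trans (Finset.sum_le_sum fun i _ => ?_)
    rw [norm_mul]
    have hσi := hσ i
    have : σ i * ‖c i‖ * (‖a i‖ / σ i) = ‖c i‖ * ‖a i‖ := by field_simp
    rw [this]
  have h0 : 0 ≤ ∑ i ∈ s, (σ i * ‖c i‖) * (‖a i‖ / σ i) :=
    Finset.sum_nonneg fun i _ => mul_nonneg (mul_nonneg (hσ i).le (norm_nonneg _)) (div_nonneg (norm_nonneg _) (hσ i).le)
  calc ‖∑ i ∈ s, c i * a i‖ ^ 2 ≤ (∑ i ∈ s, (σ i * ‖c i‖) * (‖a i‖ / σ i)) ^ 2 := pow_le_pow_left₀ (norm_nonneg _) h1 2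
    _ ≤ (∑ i ∈ s, (σ i * ‖c i‖) ^ 2) * (∑ i ∈ s, (‖a i‖ / σ i) ^ 2) := Finset.sum_mul_sq_le_sq_mul_sq s _ _

/-- [folklore] **THE CLASS-PARSEVAL BOUND**: with weights `σ_m > 0`, a termwise reading bound `(σ_m·‖c_m‖)² ≤ w_m` and class sums `Σ_{cls L m = m′} w_m ≤ W`,
`Σ_{z ∈ (ℤ∕L)^D} ‖Σ_m c_m·a_m·boxChar (cls L m) z‖² ≤ L^D · W · Σ_m (‖a_m‖∕σ_m)²` — Cauchy–Schwarz INSIDE each class after Parseval; the weighted `ℓ²` sum of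
`a` over ALL aliases is kept whole (it is what an a-priori bound controls). -/
theorem sum_norm_sq_boxChar_cls_le (c a : TorusSite D N → ℂ) (σ w : TorusSite D N → ℝ) (hσ : ∀ m, 0 < σ m)
    (hw : ∀ m, (σ m * ‖c m‖) ^ 2 ≤ w m) {W : ℝ}
    (hW : ∀ m' : TorusSite D L, ∑ m ∈ Finset.univ.filter (fun m : TorusSite D N => cls L m = m'), w m ≤ W) :
    ∑ z : TorusSite D L, ‖∑ m : TorusSite D N, c m * a m * boxChar (cls L m) z‖ ^ 2
      ≤ (L : ℝ) ^ D * W * ∑ m : TorusSite D N, (‖a m‖ / σ m) ^ 2 := by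
  rw [sum_norm_sq_boxChar_cls (fun m => c m * a m)]
  have hcls : ∀ m' : TorusSite D L,
      ‖∑ m ∈ Finset.univ.filter (fun m : TorusSite D N => cls L m = m'), c m * a m‖ ^ 2
        ≤ W * ∑ m ∈ Finset.univ.filter (fun m : TorusSite D N => cls L m = m'), (‖a m‖ / σ m) ^ 2 := by
    intro m'
    refine (norm_sum_mul_sq_le_finset _ c a σ hσ).trans ?_
    refine mul_le_mul_of_nonneg_right ?_ (Finset.sum_nonneg fun _ _ => sq_nonneg _)
    exact (Finset.sum_le_sum fun m _ => hw m).trans (hW m')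
  calc (L : ℝ) ^ D * ∑ m', ‖∑ m ∈ Finset.univ.filter (fun m : TorusSite D N => cls L m = m'), c m * a m‖ ^ 2
      ≤ (L : ℝ) ^ D * ∑ m' : TorusSite D L, W * ∑ m ∈ Finset.univ.filter (fun m : TorusSite D N => cls L m = m'), (‖a m‖ / σ m) ^ 2 :=
        mul_le_mul_of_nonneg_left (Finset.sum_le_sum fun m' _ => hcls m') (by positivity)
    _ = (L : ℝ) ^ D * W * ∑ m : TorusSite D N, (‖a m‖ / σ m) ^ 2 := by
        rw [← Finset.mul_sum, Finset.sum_fiberwise Finset.univ (cls L) (fun m : TorusSite D N => (‖a m‖ / σ m) ^ 2), mul_assoc]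

end CauchySchwarz

end Summit.QuantumFields.BalabanUV.Beta.GAN24.AliasClassSum

end
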